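import Summits.QuantumFields.YangMills.Theorems.IR.BetaSlopeFloorTransport
import Summits.QuantumFields.YangMills.Theorems.SoloBlindOddTorusCorrelator

/-!
# Line `beta-slope-floor` (crux `IR`, stmt-QuantumFields-19354): `stub_gronwall` of skeleton REV 2 (running unit + window regularity) PROVED

Route `BalabanLadder`, crux `IR`, line `beta-slope-floor` (ideator ym-ir-idea-2), lead prover `ym-ir-line-bsf-p1`.
The ideator's skeleton rev 2 (card rev 5; both critics asked to TYPE the silent hypothesis) lets the unit RUN with the
coupling inside the window — the floor reads `(c·a(b)·n − K_A)·D_b ≤ ∂_b D_b` for `b ∈ [β, β+1]` — and isolates the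
window regularity `WindowRegular a : ∃ κ > 0, β₂, ∀ β ≥ β₂, ∀ b ∈ [β, β+1], κ·a(β) ≤ a(b)` as its own stub
(`stub_windowRegularity`, consumes simplicity).  The rev-2 transport stub is then

  `stub_gronwall : (∀ β, 0 < a β) → WindowRegular a → SlopeFloor r a → WindowDomination r a`

(running floor in, frozen-unit window domination `D_β ≤ K_A e^{−(cκ)·a(β)·n} D_{β+1}` out).  This module proves it
(`stub_gronwall_running`, the rev-2 signature with the skeleton's `WindowRegular`, `IsSliceObs`, `diagCorr`,
`SlopeFloor`, `WindowDomination` δ-unfolded; the skeleton cites it by name):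

* `frozen_floor_of_running_floor` — pointwise: `κ a(β) ≤ a(b)`, `D_b ≥ 0` turn the running floor into the frozen
  floor `((cκ)·a(β)·n − K)·D_b ≤ ∂_b D_b`;
* the sign `D_b(A;S,n) ≥ 0` is reflection positivity on the odd torus for slice species (tree
  `SoloBlind.latticeConnectedCorr_self_nonneg`, `b ≥ 0`, `S ≥ 1`; the case `n = 0` needs no sign);
* the frozen floor integrates by the landed `BetaSlopeFloor.latticeConnectedCorr_le_exp_mul_of_floor`
  (Feynman–Hellmann differentiability + monotone transport, `Theorems/IR/BetaSlopeFloorTransport.lean`).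

Constants: rate `c·κ`, threshold `max (max β₂ β₂ʷ) 0`, same `S₁`, window constant `e^{K_A}`.  Group-blind plumbing;
carries no gap content; nothing here proves the Yang–Mills mass gap (Clay); R4 closes only the conditional finite-𝕋⁴
rung `BalabanLadder.UV`.
Refs: line card `Cruxes/IR/Lines/beta-slope-floor.md` rev 5 (stubs `stub_windowRegularity`, `stub_gronwall` rev 2);
K. Osterwalder, E. Seiler, Ann. Phys. 110 (1978) §2 (reflection positivity).
-/

set_option autoImplicit false

noncomputable section

open MeasureTheory Filter Topology
open Literature.MathematicalPhysics.QuantumFieldTheory Literature.MathematicalPhysics.QuantumLattice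
open Summit.QuantumFields.YangMills.Theorems.SoloBlind

namespace Summit.QuantumFields.YangMills.Cruxes.IR.BetaSlopeFloor

/-- **Pointwise: running floor + window regularity + sign ⇒ frozen floor.**  If `κ·a_β ≤ a_b`, `D ≥ 0`, `c ≥ 0`,
`n ≥ 0` and `(c·a_b·n − K)·D ≤ D'`, then `(c·κ·a_β·n − K)·D ≤ D'`. -/
theorem frozen_floor_of_running_floor {c κ aβ ab n K D D' : ℝ} (hc : 0 ≤ c) (hn : 0 ≤ n) (hD : 0 ≤ D)
    (hκ : κ * aβ ≤ ab) (h : (c * ab * n - K) * D ≤ D') : (c * κ * aβ * n - K) * D ≤ D' := by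
  have h1 : 0 ≤ c * n * D * (ab - κ * aβ) :=
    mul_nonneg (mul_nonneg (mul_nonneg hc hn) hD) (by linarith)
  nlinarith [h1, h]

/-- **STUB 2 of line `beta-slope-floor`, skeleton REV 2 — GRÖNWALL ON THE UNIT WINDOW WITH A RUNNING UNIT**
(registered rev-2 signature with `WindowRegular`, `IsSliceObs`, `diagCorr`, `SlopeFloor`, `WindowDomination`
δ-unfolded).  For every compact `G`, lattice representation `r`, unit map `a`: window regularity
`κ·a(β) ≤ a(b)` (`b ∈ [β, β+1]`, `β ≥ β₂ʷ`) and the running slope floor `(c·a(b)·n − K_A)·D_b(A;S,n) ≤ ∂_b D_b(A;S,n)`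
(slice species `A`, `β ≥ β₂`, `S ≥ S₁ β`, `n ≤ S`, `b ∈ [β, β+1]`) give the frozen-unit window domination
`D_β(A;S,n) ≤ e^{K_A} · e^{−(c·κ)·a(β)·n} · D_{β+1}(A;S,n)` for `β ≥ max (max β₂ β₂ʷ) 0`, `S ≥ S₁ β`, `n ≤ S`.
Reflection positivity supplies `D_b ≥ 0` (slice class, `b ≥ 0`, `S ≥ 1`); the positivity of `a` is not used. -/
theorem stub_gronwall_running : ∀ (G : Type) [Group G] [TopologicalSpace G] [IsTopologicalGroup G]
    [CompactSpace G] [MeasurableSpace G] [BorelSpace G] (r : LatticeRep G) (a : ℝ → ℝ),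
    (∀ β, 0 < a β) →
    (∃ κ β₂ : ℝ, 0 < κ ∧ ∀ β : ℝ, β₂ ≤ β → ∀ b : ℝ, β ≤ b → b ≤ β + 1 → κ * a β ≤ a b) →
    (∃ (c β₂ : ℝ) (S₁ : ℝ → ℕ), 0 < c ∧ ∀ A : YMSpecies G, (∀ e ∈ A.supp, e.1 0 = 0 ∧ e.2 ≠ 0) →
      ∃ K : ℝ, ∀ β : ℝ, β₂ ≤ β → ∀ S n : ℕ, S₁ β ≤ S → n ≤ S → ∀ b : ℝ, β ≤ b → b ≤ β + 1 →
        (c * a b * n - K) * latticeConnectedCorr r.ρ b (2 * S + 1) A.F A.F n ≤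
          deriv (fun b' => latticeConnectedCorr r.ρ b' (2 * S + 1) A.F A.F n) b) →
    (∃ (c β₂ : ℝ) (S₁ : ℝ → ℕ), 0 < c ∧ ∀ A : YMSpecies G, (∀ e ∈ A.supp, e.1 0 = 0 ∧ e.2 ≠ 0) →
      ∃ K : ℝ, ∀ β : ℝ, β₂ ≤ β → ∀ S n : ℕ, S₁ β ≤ S → n ≤ S →
        latticeConnectedCorr r.ρ β (2 * S + 1) A.F A.F n ≤
          K * Real.exp (-(c * a β * n)) *
            latticeConnectedCorr r.ρ (β + 1) (2 * S + 1) A.F A.F n) := by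
  intro G _ _ _ _ _ _ r a _ hW hSF
  obtain ⟨κ, βw, hκ, hW⟩ := hW
  obtain ⟨c, β₂, S₁, hc, h⟩ := hSF
  refine ⟨c * κ, max (max β₂ βw) 0, S₁, mul_pos hc hκ, fun A hA => ?_⟩
  obtain ⟨K, hK⟩ := h A hA
  obtain ⟨CA, hCA⟩ := A.bounded
  refine ⟨Real.exp K, fun β hβ S n hS hn => ?_⟩
  have hβ₂ : β₂ ≤ β := le_trans (le_max_left _ _) ((le_max_left _ _).trans hβ)
  have hβw : βw ≤ β := le_trans (le_max_right _ _) ((le_max_left _ _).trans hβ)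
  have hβ0 : 0 ≤ β := (le_max_right _ _).trans hβ
  -- the frozen floor on the window
  have hfl : ∀ b : ℝ, β ≤ b → b ≤ β + 1 →
      (c * κ * a β * n - K) * latticeConnectedCorr r.ρ b (2 * S + 1) A.F A.F n ≤
        deriv (fun b' => latticeConnectedCorr r.ρ b' (2 * S + 1) A.F A.F n) b := by
    intro b hb1 hb2
    have hrun := hK β hβ₂ S n hS hn b hb1 hb2
    by_cases hn0 : n = 0
    · subst hn0
      simp only [Nat.cast_zero, mul_zero, zero_sub] at hrun ⊢
      exact hrun
    · have hS1 : 1 ≤ S := by omega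
      have hD : 0 ≤ latticeConnectedCorr r.ρ b (2 * S + 1) A.F A.F n :=
        latticeConnectedCorr_self_nonneg r.ρ r.continuous (hβ0.trans hb1) hS1 A hA n
      exact frozen_floor_of_running_floor hc.le (Nat.cast_nonneg n) hD (hW β hβw b hb1 hb2) hrun
  have hwin := latticeConnectedCorr_le_exp_mul_of_floor r (2 * S + 1) A.measurable A.measurable
    hCA hCA n (β := β) (l := c * κ * a β * n - K) hfl
  have hexp : Real.exp (-(c * κ * a β * n - K)) = Real.exp K * Real.exp (-(c * κ * a β * n)) := by
    rw [← Real.exp_add]; ring_nf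
  rw [hexp] at hwin
  exact hwin

end Summit.QuantumFields.YangMills.Cruxes.IR.BetaSlopeFloor

end
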